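import Mathlib.Data.List.Chain
import Mathlib.Data.List.Nodup
import Mathlib.GroupTheory.Perm.Cycle.Concrete
import HarnessLib

/-!
# Closed directed walks decompose into directed circuits modulo 2

Topic `Combinatorics/SimpleGraph`; theorems only, about lists and permutations (no graph
notions). Tools for the hard direction of Little's theorem
(`Little1975_isPfaffianBipartite_iff_not_isMatchingMinor`, `LittleTheorem.lean`): the
Fischer–Little / Norine–Little–Teo minimality argument builds an "intractable set" of directed
circuits out of two CLOSED WALKS (an alternating path followed by a return path), using that the
arc multiset of a closed directed walk is, modulo 2, a sum of directed circuits using only arcs of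
the walk (Fischer–Little 2001, Lemma 2.7: "a closed sequence of consecutive arcs is the mod-2 sum
of closed directed trails").

Encoding: a walk is a list of vertices `l` with `l.IsChain r`; it is CLOSED when
`l.head? = l.getLast?` (the last vertex repeats the first, `2 ≤ l.length`); its arcs are the
consecutive pairs `l.zip l.tail`. A directed circuit is a list `c` without repetition,
`2 ≤ c.length`, whose closure `c ++ c.take 1` is a walk; its permutation is `c.formPerm`
(Mathlib), a cyclic permutation moving every vertex of `c` to the next one.

* `zip_tail_append` — arcs of a concatenation;
* `exists_lt_getElem_eq_of_not_nodup` — a repetition, by indices;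
* `exists_circuits_of_closedWalk` — **every closed walk (for an irreflexive relation) is, arc by
  arc modulo 2, a sum of directed circuits using only its arcs** (split at a repeated vertex and
  recurse; Fischer–Little 2001, Lemma 2.7 with Remark 2.2);
* `zip_tail_cycle_eq_map_formPerm`, `count_zip_tail_cycle` — the arcs of a circuit are the pairs
  `(x, c.formPerm x)`;
* `exists_cyclePerms_of_closedWalk` — the same decomposition delivered as CYCLIC PERMUTATIONS
  `σ` moving only along `r` (`σ a = a ∨ r a (σ a)`), with, for `a ≠ b`,
  `count (a, b) (arcs of the walk) ≡ #{σ : σ a = b} (mod 2)`.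

## References

* I. Fischer, C. H. C. Little, *A characterisation of Pfaffian near bipartite graphs*, J. Combin.
  Theory Ser. B 82 (2001) 175–222, Lemma 2.7, Remark 2.2. [FischerLittle2001]
-/

namespace Literature.Combinatorics.SimpleGraph

open Equiv

section Lists

variable {α : Type*}

/-- **Arcs of a concatenation of walks**: the consecutive pairs of `P ++ Q` are those of `P`, the
junction pair, and those of `Q`. [folklore] -/
theorem zip_tail_append (P Q : List α) (hP : P ≠ []) (hQ : Q ≠ []) :
    (P ++ Q).zip (P ++ Q).tail = P.zip P.tail ++ (P.getLast hP, Q.head hQ) :: Q.zip Q.tail := by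
  induction P with
  | nil => exact absurd rfl hP
  | cons a P ih =>
    cases P with
    | nil =>
      obtain ⟨b, Q', rfl⟩ := List.exists_cons_of_ne_nil hQ
      rfl
    | cons b P' =>
      have h := ih (List.cons_ne_nil _ _)
      simp only [List.cons_append, List.tail_cons, List.zip_cons_cons] at h ⊢
      rw [h]
      rfl

/-- The consecutive pairs of a chain are related. [folklore] -/
theorem rel_of_mem_zip_tail {r : α → α → Prop} {l : List α} (h : l.IsChain r) {p : α × α}
    (hp : p ∈ l.zip l.tail) : r p.1 p.2 := by
  obtain ⟨i, hi, rfl⟩ := List.getElem_of_mem hp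
  simp only [List.length_zip, List.length_tail] at hi
  rw [List.getElem_zip]
  simp only [List.getElem_tail]
  exact List.isChain_iff_getElem.1 h i (by omega)

/-- **A list with a repetition repeats at two indices.** [folklore] -/
theorem exists_lt_getElem_eq_of_not_nodup [DecidableEq α] {l : List α} (h : ¬ l.Nodup) :
    ∃ (i j : ℕ) (hi : i < l.length) (hj : j < l.length), i < j ∧ l[i] = l[j] := by
  induction l with
  | nil => exact absurd List.nodup_nil h
  | cons a l ih =>
    rw [List.nodup_cons, not_and_or, not_not] at h
    rcases h with ha | hl
    · obtain ⟨j, hj, hja⟩ := List.getElem_of_mem ha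
      exact ⟨0, j + 1, by simp, by simpa using hj, by omega, by simp [hja]⟩
    · obtain ⟨i, j, hi, hj, hij, heq⟩ := ih hl
      exact ⟨i + 1, j + 1, by simpa using hi, by simpa using hj, by omega, by simpa using heq⟩

/-- **Splitting a closed walk at a repeated vertex.** If `l = P ++ M ++ S` with `P, M, S`
nonempty and `P` and `M` ending in the same vertex `x`, then the arcs of `l` are exactly the arcs
of the two shorter closed walks `P ++ S` and `x :: M`, counted with multiplicity. [folklore] -/
theorem count_zip_tail_split [DecidableEq α] (P M S : List α) (hP : P ≠ []) (hM : M ≠ [])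
    (hS : S ≠ []) (hx : P.getLast hP = M.getLast hM) (p : α × α) :
    ((P ++ M ++ S).zip (P ++ M ++ S).tail).count p =
      ((P ++ S).zip (P ++ S).tail).count p + ((P.getLast hP :: M).zip (P.getLast hP :: M).tail).count p := by
  have hMS : M ++ S ≠ [] := by simp [hM]
  rw [List.append_assoc, zip_tail_append P (M ++ S) hP hMS, zip_tail_append M S hM hS,
    zip_tail_append P S hP hS]
  obtain ⟨m, M', rfl⟩ := List.exists_cons_of_ne_nil hM
  simp only [List.cons_append, List.head_cons, List.tail_cons, List.zip_cons_cons,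
    List.count_append, List.count_cons, hx]
  omega

end Lists

section Walks

variable {α : Type*} [DecidableEq α] {r : α → α → Prop}

omit [DecidableEq α] in
/-- A closed walk for an irreflexive relation has at least three vertices (the last repeating the
first). [folklore] -/
theorem three_le_length_of_closedWalk (hirr : ∀ x, ¬ r x x) {l : List α} (h2 : 2 ≤ l.length)
    (hc : l.IsChain r) (hcl : l.head? = l.getLast?) : 3 ≤ l.length := by
  by_contra hlt
  have hlen : l.length = 2 := by omega
  obtain ⟨a, b, rfl⟩ : ∃ a b, l = [a, b] := by
    match l, hlen with
    | [a, b], _ => exact ⟨a, b, rfl⟩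
  simp only [List.head?_cons, List.getLast?_cons_cons, List.getLast?_singleton,
    Option.some.injEq] at hcl
  subst hcl
  exact hirr a (List.isChain_pair.1 hc)

/-- **Every closed walk is, modulo 2, a sum of directed circuits using only its arcs**
(Fischer–Little 2001, Lemma 2.7 with Remark 2.2). For an irreflexive relation `r` and a closed
walk `l` (`2 ≤ l.length`, `l.IsChain r`, `l.head? = l.getLast?`) there is a list of circuits
`c` — no repeated vertex, `2 ≤ c.length`, closure `c ++ c.take 1` an `r`-chain, arcs among the
arcs of `l` — such that every pair is an arc of `l` as often, modulo 2, as it is an arc of the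
circuits altogether. Proof: a walk without repetition (but the closing one) is a circuit; else
split at a repeated vertex into two shorter closed walks. [cite: FischerLittle2001, Lemma 2.7] -/
theorem exists_circuits_of_closedWalk (hirr : ∀ x, ¬ r x x) (l : List α) (h2 : 2 ≤ l.length)
    (hc : l.IsChain r) (hcl : l.head? = l.getLast?) :
    ∃ C : List (List α), (∀ c ∈ C, c.Nodup ∧ 2 ≤ c.length ∧ (c ++ c.take 1).IsChain r ∧
        ∀ p ∈ (c ++ c.take 1).zip (c ++ c.take 1).tail, p ∈ l.zip l.tail) ∧
      ∀ p : α × α, (l.zip l.tail).count p % 2 =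
        (C.map fun c => ((c ++ c.take 1).zip (c ++ c.take 1).tail).count p).sum % 2 := by
  -- strong induction on the length
  suffices H : ∀ (N : ℕ) (l : List α), l.length ≤ N → 2 ≤ l.length → l.IsChain r →
      l.head? = l.getLast? →
      ∃ C : List (List α), (∀ c ∈ C, c.Nodup ∧ 2 ≤ c.length ∧ (c ++ c.take 1).IsChain r ∧
        ∀ p ∈ (c ++ c.take 1).zip (c ++ c.take 1).tail, p ∈ l.zip l.tail) ∧
      ∀ p : α × α, (l.zip l.tail).count p % 2 =
        (C.map fun c => ((c ++ c.take 1).zip (c ++ c.take 1).tail).count p).sum % 2 from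
    H _ l le_rfl h2 hc hcl
  intro N
  induction N with
  | zero => intro l hN h2; omega
  | succ N ih =>
    intro l hN h2 hc hcl
    have h3 := three_le_length_of_closedWalk hirr h2 hc hcl
    have hne : l ≠ [] := List.ne_nil_of_length_pos (by omega)
    have hheadlast : l.head hne = l.getLast hne := by
      rw [List.head?_eq_some_head hne, List.getLast?_eq_some_getLast hne, Option.some.injEq] at hcl
      exact hcl
    by_cases hnd : l.dropLast.Nodup
    · -- a circuit
      refine ⟨[l.dropLast], fun c hc' => ?_, fun p => ?_⟩
      · rw [List.mem_singleton] at hc'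
        subst hc'
        have hcl' : l.dropLast ++ l.dropLast.take 1 = l := by
          have hdne : l.dropLast ≠ [] := List.ne_nil_of_length_pos (by simp; omega)
          rw [List.take_one, List.head?_eq_some_head hdne, Option.toList_some, List.head_dropLast,
            hheadlast, List.dropLast_append_getLast]
        refine ⟨hnd, by simp; omega, by rw [hcl']; exact hc, fun p hp => by rwa [hcl'] at hp⟩
      · have hcl' : l.dropLast ++ l.dropLast.take 1 = l := by
          have hdne : l.dropLast ≠ [] := List.ne_nil_of_length_pos (by simp; omega)
          rw [List.take_one, List.head?_eq_some_head hdne, Option.toList_some, List.head_dropLast,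
            hheadlast, List.dropLast_append_getLast]
        simp [hcl']
    · -- split at a repeated vertex `l[i] = l[j]`, `i < j < length - 1`
      obtain ⟨i, j, hi, hj, hij, heq⟩ := exists_lt_getElem_eq_of_not_nodup hnd
      simp only [List.length_dropLast] at hi hj
      simp only [List.getElem_dropLast] at heq
      set P := l.take (i + 1) with hPdef
      set M := (l.drop (i + 1)).take (j - i) with hMdef
      set S := l.drop (j + 1) with hSdef
      have hlPMS : l = P ++ M ++ S := by
        rw [hPdef, hMdef, hSdef, ← List.take_add, show i + 1 + (j - i) = j + 1 by omega,
          List.take_append_drop]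
      have hP : P ≠ [] := by simp [hPdef, hne]
      have hM : M ≠ [] := by
        simp only [hMdef, ne_eq, List.take_eq_nil_iff, List.drop_eq_nil_iff, not_or, not_le]
        omega
      have hS : S ≠ [] := by
        simp only [hSdef, ne_eq, List.drop_eq_nil_iff, not_le]; omega
      have hPlast : P.getLast hP = l[i] := by
        rw [List.getLast_eq_getElem]
        simp [hPdef, List.length_take, Nat.min_eq_left (by omega : i + 1 ≤ l.length)]
      have hMlast : M.getLast hM = l[j] := by
        rw [List.getLast_eq_getElem]
        simp only [hMdef, List.getElem_take, List.getElem_drop, List.length_take, List.length_drop]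
        congr 1
        rw [Nat.min_eq_left (by omega)]
        omega
      have hx : P.getLast hP = M.getLast hM := by rw [hPlast, hMlast, heq]
      -- the two shorter closed walks
      set W₁ := P ++ S with hW₁
      set W₂ := P.getLast hP :: M with hW₂
      have hlenP : P.length = i + 1 := by simp [hPdef]; omega
      have hlenM : M.length = j - i := by simp [hMdef]; omega
      have hlenS : S.length = l.length - (j + 1) := by simp [hSdef]
      have hlen₁ : W₁.length < l.length ∧ 2 ≤ W₁.length := by
        simp only [hW₁, List.length_append, hlenP, hlenS]; omega
      have hlen₂ : W₂.length < l.length ∧ 2 ≤ W₂.length := by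
        simp only [hW₂, List.length_cons, hlenM]; omega
      -- chains
      have hcPMS : (P ++ (M ++ S)).IsChain r := by rw [← List.append_assoc, ← hlPMS]; exact hc
      have hcP : P.IsChain r := hcPMS.left_of_append
      have hcMS : (M ++ S).IsChain r := hcPMS.right_of_append
      have hcM : M.IsChain r := hcMS.left_of_append
      have hcS : S.IsChain r := hcMS.right_of_append
      have hMS : M ++ S ≠ [] := by simp [hM]
      have hjPM : r (P.getLast hP) ((M ++ S).head hMS) := hcPMS.rel_getLast_head_of_append hP hMS
      have hjMS : r (M.getLast hM) (S.head hS) := hcMS.rel_getLast_head_of_append hM hS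
      have hc₁ : W₁.IsChain r := by
        rw [hW₁, List.isChain_append]
        refine ⟨hcP, hcS, fun x hx' y hy => ?_⟩
        rw [List.getLast?_eq_some_getLast hP, Option.mem_def, Option.some.injEq] at hx'
        rw [List.head?_eq_some_head hS, Option.mem_def, Option.some.injEq] at hy
        subst hx' hy
        rw [hx]; exact hjMS
      have hc₂ : W₂.IsChain r := by
        rw [hW₂]
        refine List.IsChain.cons hcM fun y hy => ?_
        rw [List.head?_eq_some_head hM, Option.mem_def, Option.some.injEq] at hy
        subst hy
        rw [List.head_append_of_ne_nil] at hjPM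
        exact hjPM
      -- closedness
      have hcl₁ : W₁.head? = W₁.getLast? := by
        have h1 : l.head? = P.head? := by
          rw [hlPMS, List.append_assoc, List.head?_append, List.head?_eq_some_head hP, Option.some_or]
        have h2' : l.getLast? = S.getLast? := by
          rw [hlPMS, List.getLast?_append, List.getLast?_eq_some_getLast hS, Option.some_or]
        rw [hW₁, List.head?_append, List.head?_eq_some_head hP, Option.some_or, List.getLast?_append,
          List.getLast?_eq_some_getLast hS, Option.some_or, ← List.head?_eq_some_head hP, ← h1, hcl, h2',
          List.getLast?_eq_some_getLast hS]
      have hcl₂ : W₂.head? = W₂.getLast? := by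
        rw [hW₂, List.head?_cons, List.getLast?_eq_some_getLast (List.cons_ne_nil _ _),
          List.getLast_cons hM, ← hx]
      -- recurse
      obtain ⟨C₁, hC₁, hcount₁⟩ := ih W₁ (by omega) hlen₁.2 hc₁ hcl₁
      obtain ⟨C₂, hC₂, hcount₂⟩ := ih W₂ (by omega) hlen₂.2 hc₂ hcl₂
      -- arcs of the pieces are arcs of `l`
      have hsub₁ : ∀ p ∈ W₁.zip W₁.tail, p ∈ l.zip l.tail := by
        intro p hp
        rw [hlPMS, List.append_assoc, zip_tail_append P (M ++ S) hP hMS,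
          zip_tail_append M S hM hS]
        rw [hW₁, zip_tail_append P S hP hS] at hp
        simp only [List.mem_append, List.mem_cons] at hp ⊢
        rcases hp with hp | rfl | hp
        · exact Or.inl hp
        · right; right; right; left; rw [hx]
        · exact Or.inr (Or.inr (Or.inr (Or.inr hp)))
      have hsub₂ : ∀ p ∈ W₂.zip W₂.tail, p ∈ l.zip l.tail := by
        intro p hp
        rw [hlPMS, List.append_assoc, zip_tail_append P (M ++ S) hP hMS,
          zip_tail_append M S hM hS, List.head_append_of_ne_nil hM]
        obtain ⟨m, M', hmM⟩ := List.exists_cons_of_ne_nil hM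
        rw [hW₂, hmM] at hp
        simp only [List.tail_cons, List.zip_cons_cons, List.mem_cons] at hp
        simp only [List.mem_append, List.mem_cons, hmM, List.head_cons, List.tail_cons]
        rcases hp with rfl | hp
        · exact Or.inr (Or.inl rfl)
        · exact Or.inr (Or.inr (Or.inl hp))
      refine ⟨C₁ ++ C₂, fun c hc' => ?_, fun p => ?_⟩
      · rcases List.mem_append.1 hc' with h | h
        · obtain ⟨h1, h2', h3', h4⟩ := hC₁ c h
          exact ⟨h1, h2', h3', fun p hp => hsub₁ p (h4 p hp)⟩
        · obtain ⟨h1, h2', h3', h4⟩ := hC₂ c h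
          exact ⟨h1, h2', h3', fun p hp => hsub₂ p (h4 p hp)⟩
      · rw [List.map_append, List.sum_append, Nat.add_mod, ← hcount₁, ← hcount₂, ← Nat.add_mod,
          hlPMS, count_zip_tail_split P M S hP hM hS hx p]

end Walks

/-! ### From circuits (lists) to cyclic permutations -/

section FormPerm

variable {α : Type*} [DecidableEq α]

/-- **The arcs of a circuit are the pairs `(x, c.formPerm x)`.** [folklore] -/
theorem zip_tail_cycle_eq_map_formPerm (c : List α) (hn : c.Nodup) (h2 : 2 ≤ c.length) :
    (c ++ c.take 1).zip (c ++ c.take 1).tail = c.map fun x => (x, c.formPerm x) := by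
  have hne : c ≠ [] := List.ne_nil_of_length_pos (by omega)
  have htake : c.take 1 = [c.head hne] := by
    rw [List.take_one, List.head?_eq_some_head hne, Option.toList_some]
  apply List.ext_getElem
  · simp [htake]
  · intro k hk hk'
    simp only [List.length_map] at hk'
    rw [List.getElem_zip, List.getElem_map]
    simp only [List.getElem_tail, Prod.mk.injEq]
    constructor
    · exact List.getElem_append_left hk'
    · rw [List.formPerm_apply_getElem c hn k hk']
      apply Option.some_injective
      rw [← List.getElem?_eq_getElem, ← List.getElem?_eq_getElem]
      by_cases hk1 : k + 1 < c.length
      · rw [List.getElem?_append_left hk1, Nat.mod_eq_of_lt hk1]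
      · have hkeq : k + 1 = c.length := by omega
        rw [List.getElem?_append_right (by omega), hkeq, Nat.sub_self, Nat.mod_self, htake,
          List.getElem?_singleton, List.head_eq_getElem, List.getElem?_eq_getElem (by omega)]
        rfl

/-- The number of times `(a, b)`, `a ≠ b`, is an arc of a circuit: once if `c.formPerm a = b`,
never otherwise. [folklore] -/
theorem count_zip_tail_cycle (c : List α) (hn : c.Nodup) (h2 : 2 ≤ c.length) {a b : α}
    (hab : a ≠ b) :
    ((c ++ c.take 1).zip (c ++ c.take 1).tail).count (a, b) = if c.formPerm a = b then 1 else 0 := by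
  rw [zip_tail_cycle_eq_map_formPerm c hn h2, List.count_eq_countP, List.countP_map]
  have hcongr : c.countP ((fun p => p == (a, b)) ∘ fun x => (x, c.formPerm x)) =
      c.countP fun x => x == a && decide (c.formPerm a = b) := by
    apply List.countP_congr
    intro x _
    simp only [Function.comp_apply, beq_iff_eq, Prod.mk.injEq, Bool.and_eq_true, decide_eq_true_eq]
    constructor
    · rintro ⟨rfl, h⟩; exact ⟨rfl, h⟩
    · rintro ⟨rfl, h⟩; exact ⟨rfl, h⟩
  rw [hcongr]
  by_cases h : c.formPerm a = b
  · rw [if_pos h]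
    have ha : a ∈ c := List.mem_of_formPerm_apply_ne (by rw [h]; exact Ne.symm hab)
    simp only [h, decide_true, Bool.and_true]
    rw [← List.count_eq_countP]  -- countP (· == a) = count a
    exact List.count_eq_one_of_mem hn ha
  · rw [if_neg h]
    simp [h]

/-- A circuit's permutation moves every vertex along the relation (or fixes it). [folklore] -/
theorem formPerm_apply_rel_of_isChain {r : α → α → Prop} (c : List α) (hn : c.Nodup)
    (h2 : 2 ≤ c.length) (hc : (c ++ c.take 1).IsChain r) (a : α) :
    c.formPerm a = a ∨ r a (c.formPerm a) := by
  by_cases ha : a ∈ c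
  · right
    have hmem : (a, c.formPerm a) ∈ (c ++ c.take 1).zip (c ++ c.take 1).tail := by
      rw [zip_tail_cycle_eq_map_formPerm c hn h2]
      exact List.mem_map.2 ⟨a, ha, rfl⟩
    exact rel_of_mem_zip_tail hc hmem
  · exact Or.inl (List.formPerm_apply_of_notMem ha)

/-- Sums of indicators over a list are counts. [folklore] -/
theorem sum_map_ite_eq_countP {β : Type*} (L : List β) (p : β → Prop) [DecidablePred p] :
    (L.map fun x => if p x then 1 else 0).sum = L.countP fun x => p x := by
  induction L with
  | nil => simp
  | cons x L ih =>
    rw [List.map_cons, List.sum_cons, ih]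
    by_cases hx : p x
    · rw [if_pos hx, List.countP_cons_of_pos (by simpa using hx)]; omega
    · rw [if_neg hx, List.countP_cons_of_neg (by simpa using hx)]; omega

/-- **Closed walks decompose into cyclic permutations modulo 2.** For an irreflexive relation `r`
on a finite type and a closed walk `l`, there is a list of cyclic permutations `σ`, each moving
every point along `r` or fixing it, and moving points only along arcs of `l`, such that for all
`a ≠ b` the number of `σ` with `σ a = b` has the parity of the number of times `(a, b)` is an arc
of `l`. [cite: FischerLittle2001, Lemma 2.7] -/
theorem exists_cyclePerms_of_closedWalk [Fintype α] {r : α → α → Prop} (hirr : ∀ x, ¬ r x x)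
    (l : List α) (h2 : 2 ≤ l.length) (hc : l.IsChain r) (hcl : l.head? = l.getLast?) :
    ∃ Γ : List (Perm α), (∀ σ ∈ Γ, σ.IsCycle ∧ (∀ a, σ a = a ∨ r a (σ a)) ∧
        ∀ a, σ a ≠ a → (a, σ a) ∈ l.zip l.tail) ∧
      ∀ a b, a ≠ b → (l.zip l.tail).count (a, b) % 2 = (Γ.countP fun σ => σ a = b) % 2 := by
  obtain ⟨C, hC, hcount⟩ := exists_circuits_of_closedWalk hirr l h2 hc hcl
  refine ⟨C.map List.formPerm, fun σ hσ => ?_, fun a b hab => ?_⟩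
  · obtain ⟨c, hcC, rfl⟩ := List.mem_map.1 hσ
    obtain ⟨hn, h2c, hcc, hsub⟩ := hC c hcC
    refine ⟨List.isCycle_formPerm hn h2c, formPerm_apply_rel_of_isChain c hn h2c hcc, fun a ha => ?_⟩
    apply hsub
    rw [zip_tail_cycle_eq_map_formPerm c hn h2c]
    exact List.mem_map.2 ⟨a, List.mem_of_formPerm_apply_ne ha, rfl⟩
  · rw [hcount, List.countP_map]
    have h1 : (C.map fun c => ((c ++ c.take 1).zip (c ++ c.take 1).tail).count (a, b)) =
        C.map fun c => if c.formPerm a = b then 1 else 0 := by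
      apply List.map_congr_left
      intro c hcC
      obtain ⟨hn, h2c, -, -⟩ := hC c hcC
      exact count_zip_tail_cycle c hn h2c hab
    rw [h1, sum_map_ite_eq_countP]
    rfl

end FormPerm

end Literature.Combinatorics.SimpleGraph
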